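import Summits.QuantumFields.BalabanUV.T4Continuum.Support.NE7GradientCurrencyCovariant
import HarnessLib

/-!
# T⁴ programme, row NE7 — (158b) THE GRADIENT CURRENCY WITH THE REACTION IN EULER–LAGRANGE FORM: the Landau reaction read on
# `S = (W − W⁻¹)∕2 = sinh A` (the lattice Landau condition a minimising gauge delivers), absorbed like the plaquette remainder (`NE7GradientCurrencyLandauEL`)

Cell `pub-balaban`, rung (B)+1 sub-cell t4, row NE7.  Lineage `b2b-balaban-t4-ne7-p2` (CRUX PROVER NE7 #2 = co-owner of row NE7), generation 88;
a variant of (157)∕(158) in the chain (156)–(159) «THE GRADIENT CURRENCY `a₁` OF REP♭ IS NOT AN INDEPENDENT LETTER».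

WHY.  (157) takes the Landau reaction in the LOG chart: a bound `P` on the forward differences of `div A` (`A = log W` bondwise) — the
[Balaban1985RegularSpaces] (1.38)∕(1.39) TYPE.  A representative obtained by MINIMISING the link functional `Σ_b ‖U^u(b) − 1‖²` over a gauge class
(the OWNER t4-ne7-p1 g72's N3a `NE7LinkFunctionalMinimiser.exists_linkMinimiser`) satisfies instead the Euler–Lagrange equation of that functional, the
LATTICE LANDAU CONDITION on the odd part of the links: `Σ_μ [S(x,μ) − S(x−e_μ,μ)] = (reaction at x)`, `S = (W − W⁻¹)∕2` (`= sinh A` for `W = e^{A}`; the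
reaction vanishes identically for a one-point normalisation).  This file threads that form through (157)'s absorption: `sinh A − A` is `(e^ρ − 1)`-Lipschitz
on `‖·‖ ≤ ρ` ((154a)'s tail letter twice), so `∇div A` and `∇div S` differ by `2d(e^ρ − 1)·‖∇A‖_∞`, absorbed on the left with the plaquette remainder once
`144·d·R·ρ ≤ 1` (still inside THE END's regime `M·a₀ ≤ 1∕(300(d+1))`).

WHAT ([folklore]; 0 def, 0 sorry):
* §1 `norm_sinhRem_sub_sinhRem_le` (‖(sinh X − X) − (sinh Y − Y)‖ ≤ (e^ρ − 1)‖X − Y‖, written with `(e^X − e^{−X})∕2`),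
  `norm_dDiv_sub_dDiv_sinh_le` (the two reaction gradients differ by `2d(e^ρ−1)·G` under an a priori gradient bound `G`).
* §2 **`norm_fdiff_le_of_plaqDiv_periodic_EL`**: (157)'s torus theorem with `P` a bound on the forward differences of `div S` instead of `div A`:
  `‖∇A‖_∞ ≤ 4(dρ∕R + R(J + P))` once `ρ ≤ 1∕64`, `144dRρ ≤ 1`.
* §3 **`gradient_currency_of_covDiv_EL`**: (158)'s docked theorem with the reaction in Euler–Lagrange form on `W = U^{u₀} = e^{A₀}`:
  `‖A₀(y+e_τ)_κ − A₀(y)_κ‖ ≤ 4(d·a₀∕R + R(j + dε((e^{2a₀}−1) + 2ε(2+ε)) + r))` under `144dRa₀ ≤ 1`.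

HONEST FRAMING (page 1): elementary; the sup currency `a₀`, the flux-divergence bound `j` and the Euler–Lagrange reaction `r` are HYPOTHESES; no minimiser is
constructed or used here; nothing of Bałaban's asserted; (APE) NOT proved; NE7 NOT PRINTED ∕ NOT PROVED; spine 0∕9; finite T⁴ rung (B)+1 — NOT infinite volume,
NOT mass gap, NOT Clay.  Continuum YM on T⁴ ⇐ BetaPertH ∧ nine spine estimates (0/9 proved); BetaPertH ⇐ (D1) ∧ (D4) ∧ CAP+tail; G-an2-4 gates asym, D1 and
NE2/3/4.  No `sorry`.  PLACEMENT: our lemma, under `Summits/QuantumFields/BalabanUV/`.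
-/

set_option autoImplicit false

open NormedSpace
open scoped BigOperators Matrix.Norms.L2Operator
open Finset

namespace Summit.QuantumFields.BalabanUV.T4Continuum.NE7GradientCurrencyLandauEL

open Literature.MathematicalPhysics.QuantumFieldTheory.Balaban1983to89
open B7Prop1Explicit B7Prop2Explicit
open B8Ineq132 (covDiv)
open T4AveragingDeficitWall (vary SmallField)
open T4AveragingDeficitWallBoundary (periodBox mem_periodBox)
open AveragingDeficitPeriodicCounting (IsPeriodicDir)
open AveragingDeficitTorusChart (periodic_smul_vec)
open SkeletonLattice (cdiv cmod smul_cdiv_add_cmod cmod_nonneg cmod_lt)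
open BlockAveragePushDirSplit (flat)
open NE7ExpLogSecondOrder (norm_expTail_sub_expTail_le)
open NE7GradientCurrency (norm_fdiff_le_of_plaqDiv)
open NE7GradientCurrencyCovariant (norm_plaqDivFlat_le_covDiv_gaugeAct)

noncomputable section

/-! ## §1 `sinh A − A` is `(e^ρ − 1)`-Lipschitz; the two reaction gradients -/

section Algebra

variable {𝔸 : Type*} [NormedRing 𝔸] [NormedAlgebra ℂ 𝔸] [CompleteSpace 𝔸] [NormOneClass 𝔸]

/-- **`sinh − id` IS `(e^ρ − 1)`-LIPSCHITZ ON `‖·‖ ≤ ρ`**: with `sinh X = (e^X − e^{−X})∕2`,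
`‖((e^X − e^{−X})∕2 − X) − ((e^Y − e^{−Y})∕2 − Y)‖ ≤ (e^ρ − 1)·‖X − Y‖` ((154a)'s tail letter at `±X, ±Y`). [folklore] -/
theorem norm_sinhRem_sub_sinhRem_le {X Y : 𝔸} {ρ : ℝ} (hX : ‖X‖ ≤ ρ) (hY : ‖Y‖ ≤ ρ) :
    ‖((2 : ℂ)⁻¹ • (exp X - exp (-X)) - X) - ((2 : ℂ)⁻¹ • (exp Y - exp (-Y)) - Y)‖ ≤ (Real.exp ρ - 1) * ‖X - Y‖ := by
  have h1 := norm_expTail_sub_expTail_le hX hY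
  have h2 := norm_expTail_sub_expTail_le (ρ := ρ) (x := -X) (y := -Y) (by rwa [norm_neg]) (by rwa [norm_neg])
  have hid : ((2 : ℂ)⁻¹ • (exp X - exp (-X)) - X) - ((2 : ℂ)⁻¹ • (exp Y - exp (-Y)) - Y)
      = (2 : ℂ)⁻¹ • (((exp X - 1 - X) - (exp Y - 1 - Y)) - ((exp (-X) - 1 - -X) - (exp (-Y) - 1 - -Y))) := by
    module
  rw [hid, norm_smul, norm_inv, Complex.norm_ofNat]
  have hXY : ‖-X - -Y‖ = ‖X - Y‖ := by rw [← norm_neg]; congr 1; abel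
  rw [hXY] at h2
  calc 2⁻¹ * ‖((exp X - 1 - X) - (exp Y - 1 - Y)) - ((exp (-X) - 1 - -X) - (exp (-Y) - 1 - -Y))‖
      ≤ 2⁻¹ * ((Real.exp ρ - 1) * ‖X - Y‖ + (Real.exp ρ - 1) * ‖X - Y‖) :=
        mul_le_mul_of_nonneg_left ((norm_sub_le _ _).trans (add_le_add h1 h2)) (by norm_num)
    _ = (Real.exp ρ - 1) * ‖X - Y‖ := by ring

end Algebra

section Carriers

variable {d : ℕ} {n : Type*} [Fintype n] [DecidableEq n] [Nonempty n]

/-- **THE TWO REACTION GRADIENTS DIFFER BY AN ABSORBABLE TERM**: for `A` with `‖A‖ ≤ ρ`, an a priori gradient bound `G`, and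
`S(b) = (e^{A(b)} − e^{−A(b)})∕2`: the forward difference (in direction `ν`, at `x`) of `div A` and that of `div S` differ in norm by at most
`2d(e^ρ − 1)·G`. [folklore] -/
theorem norm_dDiv_sub_dDiv_sinh_le (A : Site d → Fin d → (Matrix n n ℂ)) {ρ G : ℝ}
    (hA : ∀ (x : Site d) (κ : Fin d), ‖A x κ‖ ≤ ρ) (hG : ∀ (x : Site d) (κ τ : Fin d), ‖A (x + e τ) κ - A x κ‖ ≤ G) (x : Site d) (ν : Fin d) :
    ‖(∑ μ, (A (x + e ν) μ - A (x + e ν - e μ) μ) - ∑ μ, (A x μ - A (x - e μ) μ))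
      - (∑ μ, (((2 : ℂ)⁻¹ • (exp (A (x + e ν) μ) - exp (-A (x + e ν) μ)))
                - ((2 : ℂ)⁻¹ • (exp (A (x + e ν - e μ) μ) - exp (-A (x + e ν - e μ) μ))))
          - ∑ μ, (((2 : ℂ)⁻¹ • (exp (A x μ) - exp (-A x μ))) - ((2 : ℂ)⁻¹ • (exp (A (x - e μ) μ) - exp (-A (x - e μ) μ)))))‖
      ≤ 2 * d * (Real.exp ρ - 1) * G := by
  -- termwise: `T b := sinh A(b) − A(b)`; the expression is `−[Σ_μ (T(x+ν,μ) − T(x,μ)) − Σ_μ (T(x+ν−μ,μ) − T(x−μ,μ))]`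
  set T : Site d → Fin d → (Matrix n n ℂ) := fun y μ => (2 : ℂ)⁻¹ • (exp (A y μ) - exp (-A y μ)) - A y μ with hT
  have hid : (∑ μ, (A (x + e ν) μ - A (x + e ν - e μ) μ) - ∑ μ, (A x μ - A (x - e μ) μ))
      - (∑ μ, (((2 : ℂ)⁻¹ • (exp (A (x + e ν) μ) - exp (-A (x + e ν) μ)))
                - ((2 : ℂ)⁻¹ • (exp (A (x + e ν - e μ) μ) - exp (-A (x + e ν - e μ) μ))))
          - ∑ μ, (((2 : ℂ)⁻¹ • (exp (A x μ) - exp (-A x μ))) - ((2 : ℂ)⁻¹ • (exp (A (x - e μ) μ) - exp (-A (x - e μ) μ)))))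
      = -(∑ μ, ((T (x + e ν) μ - T x μ) - (T (x + e ν - e μ) μ - T (x - e μ) μ))) := by
    simp only [hT, Finset.sum_sub_distrib]
    abel
  rw [hid, norm_neg]
  have hLip : ∀ (y : Site d) (μ : Fin d), ‖T (y + e ν) μ - T y μ‖ ≤ (Real.exp ρ - 1) * G := by
    intro y μ
    have h := norm_sinhRem_sub_sinhRem_le (hA (y + e ν) μ) (hA y μ)
    simp only [hT]
    refine h.trans (mul_le_mul_of_nonneg_left (hG y μ ν) ?_)
    have hρ0 : 0 ≤ ρ := (norm_nonneg _).trans (hA y μ)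
    have := Real.add_one_le_exp ρ
    linarith
  refine (norm_sum_le _ _).trans ?_
  calc ∑ μ, ‖(T (x + e ν) μ - T x μ) - (T (x + e ν - e μ) μ - T (x - e μ) μ)‖
      ≤ ∑ _μ : Fin d, ((Real.exp ρ - 1) * G + (Real.exp ρ - 1) * G) := Finset.sum_le_sum fun μ _ => by
          refine (norm_sub_le _ _).trans (add_le_add (hLip x μ) ?_)
          have h := hLip (x - e μ) μ
          rwa [show x - e μ + e ν = x + e ν - e μ by abel] at h
    _ = 2 * d * (Real.exp ρ - 1) * G := by
        rw [Finset.sum_const, Finset.card_univ, Fintype.card_fin, nsmul_eq_mul]; ring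

/-! ## §2 On a torus, with the reaction in Euler–Lagrange form -/

/-- **THE GRADIENT CURRENCY FROM THE SUP CURRENCY ON A TORUS, REACTION IN EULER–LAGRANGE FORM.**  As (157)'s
`norm_fdiff_le_of_plaqDiv_periodic'`, but `P` bounds the forward differences of the flat divergence of `S = (e^{A} − e^{−A})∕2` (the lattice Landau
condition of a minimising gauge reads `div S = reaction`) rather than of `div A`; regime `ρ ≤ 1∕64`, `144·d·R·ρ ≤ 1`. [folklore] -/
theorem norm_fdiff_le_of_plaqDiv_periodic_EL (hd : 1 ≤ d) {Per : ℕ} (hPer : 1 ≤ Per) (A : Site d → Fin d → (Matrix n n ℂ))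
    (hAP : IsPeriodicDir A (Per : ℤ)) {ρ J P : ℝ} (hρ : ρ ≤ 1 / 64)
    (hA : ∀ (x : Site d) (κ : Fin d), ‖A x κ‖ ≤ ρ)
    (hJ : ∀ (x : Site d) (ν : Fin d),
      ‖∑ μ, ((((hol (vary (flat (d := d) (n := n)) A 1) x (plaqWord μ ν) : (Matrix n n ℂ)ˣ) : (Matrix n n ℂ)) - 1)
              - (((hol (vary (flat (d := d) (n := n)) A 1) (x - e μ) (plaqWord μ ν) : (Matrix n n ℂ)ˣ) : (Matrix n n ℂ)) - 1))‖ ≤ J)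
    (hP : ∀ (x : Site d) (ν : Fin d),
      ‖∑ μ, (((2 : ℂ)⁻¹ • (exp (A (x + e ν) μ) - exp (-A (x + e ν) μ)))
                - ((2 : ℂ)⁻¹ • (exp (A (x + e ν - e μ) μ) - exp (-A (x + e ν - e μ) μ))))
          - ∑ μ, (((2 : ℂ)⁻¹ • (exp (A x μ) - exp (-A x μ))) - ((2 : ℂ)⁻¹ • (exp (A (x - e μ) μ) - exp (-A (x - e μ) μ))))‖ ≤ P)
    {R : ℕ} (hR : 1 ≤ R) (hsmall : 144 * (d : ℝ) * R * ρ ≤ 1) (x : Site d) (κ τ : Fin d) :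
    ‖A (x + e τ) κ - A x κ‖ ≤ 4 * ((d : ℝ) * ρ / R + R * (J + P)) := by
  classical
  -- the maximal forward difference over one period
  set S : Finset (Site d × Fin d × Fin d) :=
    (periodBox (d := d) Per) ×ˢ ((Finset.univ : Finset (Fin d)) ×ˢ (Finset.univ : Finset (Fin d))) with hS_def
  have hmemS : ∀ (y : Site d) (i j : Fin d), (cmod Per y, i, j) ∈ S := fun y i j => by
    rw [hS_def, Finset.mem_product, Finset.mem_product]
    exact ⟨(mem_periodBox).2 fun k => ⟨cmod_nonneg hPer y k, cmod_lt hPer y k⟩, Finset.mem_univ _, Finset.mem_univ _⟩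
  have hSne : S.Nonempty := ⟨_, hmemS 0 ⟨0, hd⟩ ⟨0, hd⟩⟩
  obtain ⟨q₀, -, hq₀max⟩ := Finset.exists_max_image S (fun q => ‖A (q.1 + e q.2.2) q.2.1 - A q.1 q.2.1‖) hSne
  set G : ℝ := ‖A (q₀.1 + e q₀.2.2) q₀.2.1 - A q₀.1 q₀.2.1‖ with hG_def
  have hGall : ∀ (y : Site d) (i j : Fin d), ‖A (y + e j) i - A y i‖ ≤ G := by
    intro y i j
    have hy : y = cmod Per y + (Per : ℤ) • cdiv Per y := by rw [add_comm, smul_cdiv_add_cmod]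
    have h1 : A y i = A (cmod Per y) i := by
      have h := periodic_smul_vec (f := fun z => A z i) (N := (Per : ℤ)) (fun y' i' => hAP y' i' i) (cmod Per y) (cdiv Per y)
      rwa [← hy] at h
    have hye : y + e j = (cmod Per y + e j) + (Per : ℤ) • cdiv Per y := by
      have h : y + e j = (cmod Per y + (Per : ℤ) • cdiv Per y) + e j := by rw [← hy]
      rw [h]; abel
    have h2 : A (y + e j) i = A (cmod Per y + e j) i := by
      have h := periodic_smul_vec (f := fun z => A z i) (N := (Per : ℤ)) (fun y' i' => hAP y' i' i) (cmod Per y + e j) (cdiv Per y)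
      rw [hye, h]
    rw [h1, h2]
    have hm := hq₀max (cmod Per y, i, j) (hmemS y i j)
    simpa only using hm
  -- (157) §2 at the maximising bond with the reaction moved to the log chart: `P + 2d(e^ρ − 1)G`
  have hP' : ∀ (y : Site d) (ν : Fin d), ‖∑ μ, (A (y + e ν) μ - A (y + e ν - e μ) μ) - ∑ μ, (A y μ - A (y - e μ) μ)‖
      ≤ P + 2 * d * (Real.exp ρ - 1) * G := by
    intro y ν
    have h1 := norm_dDiv_sub_dDiv_sinh_le A hA hGall y ν
    have h2 := hP y ν
    have key := norm_le_norm_add_norm_sub'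
      ((∑ μ, (A (y + e ν) μ - A (y + e ν - e μ) μ) - ∑ μ, (A y μ - A (y - e μ) μ)))
      (∑ μ, (((2 : ℂ)⁻¹ • (exp (A (y + e ν) μ) - exp (-A (y + e ν) μ)))
                - ((2 : ℂ)⁻¹ • (exp (A (y + e ν - e μ) μ) - exp (-A (y + e ν - e μ) μ))))
          - ∑ μ, (((2 : ℂ)⁻¹ • (exp (A y μ) - exp (-A y μ))) - ((2 : ℂ)⁻¹ • (exp (A (y - e μ) μ) - exp (-A (y - e μ) μ)))))
    linarith
  have hkey : G ≤ 2 * ((d : ℝ) * ρ / R + R * ((J + 4 * d * (Real.exp (4 * ρ) - 1) * G) + (P + 2 * d * (Real.exp ρ - 1) * G))) :=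
    norm_fdiff_le_of_plaqDiv A hA (fun y i j => hGall y i j) hJ hP' hR q₀.1 q₀.2.1 q₀.2.2
  have hR0 : (0 : ℝ) < R := by exact_mod_cast hR
  have hρ0 : 0 ≤ ρ := (norm_nonneg _).trans (hA 0 ⟨0, hd⟩)
  have hG0 : 0 ≤ G := norm_nonneg _
  have he4 : Real.exp (4 * ρ) - 1 ≤ 8 * ρ := exp4_sub_one_le hρ0 hρ
  have he1 : Real.exp ρ - 1 ≤ 2 * ρ := by
    have h := Real.abs_exp_sub_one_le (x := ρ) (by rw [abs_of_nonneg hρ0]; linarith)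
    rw [abs_of_nonneg hρ0] at h
    exact (le_abs_self _).trans h
  -- absorb: the `G`-coefficient is `2R(4d(e^{4ρ}−1) + 2d(e^ρ−1)) ≤ 2R·36dρ = 72dRρ ≤ 1∕2`
  have hcoef : 2 * (R : ℝ) * (4 * d * (Real.exp (4 * ρ) - 1) + 2 * d * (Real.exp ρ - 1)) ≤ 1 / 2 := by
    have hd0 : (0 : ℝ) ≤ d := by positivity
    have h1 : 4 * (d : ℝ) * (Real.exp (4 * ρ) - 1) + 2 * d * (Real.exp ρ - 1) ≤ 36 * d * ρ := by nlinarith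
    have h2 : 2 * (R : ℝ) * (4 * d * (Real.exp (4 * ρ) - 1) + 2 * d * (Real.exp ρ - 1)) ≤ 2 * R * (36 * d * ρ) :=
      mul_le_mul_of_nonneg_left h1 (by positivity)
    linarith
  have habs : 2 * (R : ℝ) * (4 * d * (Real.exp (4 * ρ) - 1) + 2 * d * (Real.exp ρ - 1)) * G ≤ 1 / 2 * G :=
    mul_le_mul_of_nonneg_right hcoef hG0
  have hGle : G ≤ 4 * ((d : ℝ) * ρ / R + R * (J + P)) := by
    have h2 : 2 * ((d : ℝ) * ρ / R + R * ((J + 4 * d * (Real.exp (4 * ρ) - 1) * G) + (P + 2 * d * (Real.exp ρ - 1) * G)))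
        = 2 * ((d : ℝ) * ρ / R + R * (J + P)) + 2 * (R : ℝ) * (4 * d * (Real.exp (4 * ρ) - 1) + 2 * d * (Real.exp ρ - 1)) * G := by ring
    rw [h2] at hkey
    linarith
  exact (hGall x κ τ).trans hGle

/-! ## §3 Docked to THE END's data with the reaction in Euler–Lagrange form -/

/-- **THE DOCKED GRADIENT CURRENCY, REACTION IN EULER–LAGRANGE FORM.**  As (158)'s `gradient_currency_of_covDiv`, but the Landau reaction is read on
the ODD PART OF THE LINKS of `W = U^{u₀} = e^{A₀}`: `r` bounds the forward differences of `Σ_μ [S(x,μ) − S(x−e_μ,μ)]`, `S(b) = (e^{A₀(b)} − e^{−A₀(b)})∕2`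
— the Euler–Lagrange expression of the link functional (it vanishes for an exact lattice Landau gauge).  Regime `144·d·R·a₀ ≤ 1`. [folklore] -/
theorem gradient_currency_of_covDiv_EL (hd : 1 ≤ d) {U : Site d → Fin d → (Matrix n n ℂ)ˣ} {ε j : ℝ} (hε0 : 0 ≤ ε) (hUε : SmallField U ε)
    (hcov : ∀ (ν : Fin d) (x : Site d), ‖covDiv 1 U ν x‖ ≤ j)
    {u₀ : Site d → (Matrix n n ℂ)ˣ} (hu₀ : ∀ y : Site d, u₀ y ∈ unitaryUnits (Matrix n n ℂ)) {A₀ : Site d → Fin d → (Matrix n n ℂ)}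
    (hgauge₀ : gaugeAct u₀ U = vary (flat (d := d) (n := n)) A₀ 1) {Per : ℕ} (hPer : 1 ≤ Per) (hA₀P : IsPeriodicDir A₀ (Per : ℤ))
    {a₀ r : ℝ} (ha₀ : ∀ (y : Site d) (κ : Fin d), ‖A₀ y κ‖ ≤ a₀) (ha₀s : a₀ ≤ 1 / 64)
    (hEL : ∀ (x : Site d) (ν : Fin d),
      ‖∑ μ, (((2 : ℂ)⁻¹ • (exp (A₀ (x + e ν) μ) - exp (-A₀ (x + e ν) μ)))
                - ((2 : ℂ)⁻¹ • (exp (A₀ (x + e ν - e μ) μ) - exp (-A₀ (x + e ν - e μ) μ))))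
          - ∑ μ, (((2 : ℂ)⁻¹ • (exp (A₀ x μ) - exp (-A₀ x μ))) - ((2 : ℂ)⁻¹ • (exp (A₀ (x - e μ) μ) - exp (-A₀ (x - e μ) μ))))‖ ≤ r)
    {R : ℕ} (hR : 1 ≤ R) (hreg : 144 * (d : ℝ) * R * a₀ ≤ 1) (y : Site d) (κ τ : Fin d) :
    ‖A₀ (y + e τ) κ - A₀ y κ‖ ≤ 4 * ((d : ℝ) * a₀ / R + R * ((j + d * (ε * ((Real.exp (2 * a₀) - 1) + 2 * ε * (2 + ε)))) + r)) :=
  norm_fdiff_le_of_plaqDiv_periodic_EL hd hPer A₀ hA₀P ha₀s ha₀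
    (fun x ν => (norm_plaqDivFlat_le_covDiv_gaugeAct hε0 hUε hu₀ hgauge₀ ha₀ x ν).trans (add_le_add (hcov ν x) le_rfl)) hEL hR hreg y κ τ

end Carriers

end

end Summit.QuantumFields.BalabanUV.T4Continuum.NE7GradientCurrencyLandauEL
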